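import Summits.HubbardSuperconductivity.HubbardSuperconductivity.Theorems.AnisotropyChordXXZWeightedHopping
import Summits.HubbardSuperconductivity.HubbardSuperconductivity.Theorems.AnisotropyChordSpinMonotoneCompleteMultipartite

/-!
# Route `AnisotropyChord`: sector ground vectors of the ferromagnetic bond-weighted XXZ Hamiltonian
# are fixed by weight-preserving graph automorphisms

Third layer of the weighted toolkit.  On a connected finite graph with bond couplings `J_e < 0` on
every edge and any anisotropy `Δ`, a sector ground vector `ψ` of `H = xxzHamiltonianWith 1 G J Δ`
(`H ψ = E_min(sector) ψ`) is FIXED by the relabelling `σ ↦ σ ∘ π` along every permutation `π` of the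
sites that preserves adjacency AND the couplings (`J(π e) = J(e)`): `xxzWith_sectorGS_comp_eq_self`.
Proof as in the unweighted `AnisotropyChord.sectorGS_comp_eq_self`: the Perron vector of the sector
(`Weighted.xxzWith_sector_perronFrobenius`) is nonnegative with positive coordinate sum, the relabelled
vector is again a sector ground vector (`xxzHamiltonianWith_submatrix_comp`), uniqueness up to
scalars and preservation of the coordinate sum force the scalar to be `1`; a general ground vector is
a multiple of the Perron vector.  This is what makes the ground state class-constant on the orbits of
the weight-preserving automorphism group (rook graphs with direction weights: `S_m × S_n`; two-ring
tori).  H. Tasaki (2020) §2.1, §2.4.  No definition is introduced.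
-/

set_option linter.dupNamespace false

noncomputable section

namespace Summit.HubbardSuperconductivity.HubbardSuperconductivity.Theorems.AnisotropyChord.Weighted

open Matrix Complex Finset
open Literature.MathematicalPhysics.QuantumLattice
open Summit.HubbardSuperconductivity.HubbardSuperconductivity.Theorems.LevyLogBootstrap
  (comp_mem_spinZSector mulVec_comp_of_submatrix_eq)
open Summit.HubbardSuperconductivity.HubbardSuperconductivity.Theorems.AnisotropyChord
  (exists_weight_of_mem_spinZSector)

variable {V : Type*} [Fintype V] [DecidableEq V]

/-- **Perron–Frobenius symmetry of sector ground vectors, weighted couplings.**  On a connected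
finite graph with `J_e < 0` on every edge, for any real `Δ`, any sector value `m` and ANY vector `ψ`
of the sector with `Hψ = E_min(m)ψ` (`H = xxzHamiltonianWith 1 G J Δ`), relabelling `σ ↦ σ ∘ π` along
a permutation `π` preserving adjacency and the couplings FIXES `ψ`.  Tasaki (2020) §2.1, §2.4.
[folklore] -/
theorem xxzWith_sectorGS_comp_eq_self (G : SimpleGraph V) [DecidableRel G.Adj] (hG : G.Connected)
    (J : Sym2 V → ℝ) (hJ : ∀ e ∈ G.edgeFinset, J e < 0) (Δ m : ℝ) (π : V ≃ V)
    (hπ : ∀ x y, G.Adj (π x) (π y) ↔ G.Adj x y) (hJπ : ∀ e : Sym2 V, J (Sym2.map π e) = J e)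
    {ψ : TensorIndex V 2 → ℂ} (hψ : ψ ∈ spinZSector (Λ := V) 1 m)
    (hH : xxzHamiltonianWith 1 G J Δ *ᵥ ψ =
      ((lowestEnergyInSector 1 (xxzHamiltonianWith 1 G J Δ) m : ℝ) : ℂ) • ψ) :
    (fun σ : TensorIndex V 2 => ψ (σ ∘ π)) = ψ := by
  by_cases hψ0 : ψ = 0
  · subst hψ0; rfl
  obtain ⟨W, hW, hmW⟩ := exists_weight_of_mem_spinZSector hψ hψ0
  subst hmW
  obtain ⟨⟨ψ₀, hψ₀K, hψ₀0, hψ₀pos, hψ₀H⟩, huniq⟩ := xxzWith_sector_perronFrobenius 1 G hG J hJ Δ W hW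
  have hHinv := xxzHamiltonianWith_submatrix_comp 1 G J Δ π hπ hJπ
  -- Step 1: the Perron vector is fixed by the relabelling.
  have hfix : (fun σ : TensorIndex V 2 => ψ₀ (σ ∘ π)) = ψ₀ := by
    set ψ₀' : TensorIndex V 2 → ℂ := fun σ => ψ₀ (σ ∘ π) with hψ₀'def
    have hK' : ψ₀' ∈ spinZSector (Λ := V) 1 (((Fintype.card V * 1 : ℕ) : ℝ) / 2 - (W : ℝ)) :=
      comp_mem_spinZSector π hψ₀K
    have hH' : xxzHamiltonianWith 1 G J Δ *ᵥ ψ₀' =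
        ((lowestEnergyInSector 1 (xxzHamiltonianWith 1 G J Δ)
          (((Fintype.card V * 1 : ℕ) : ℝ) / 2 - (W : ℝ)) : ℝ) : ℂ) • ψ₀' := by
      rw [hψ₀'def, mulVec_comp_of_submatrix_eq π hHinv ψ₀]
      funext σ
      rw [hψ₀H]
      rfl
    obtain ⟨c, hc⟩ := huniq ψ₀ ψ₀' hψ₀K hK' hψ₀H hH' hψ₀0
    have hsum : ∑ σ, ψ₀' σ = ∑ σ, ψ₀ σ :=
      Fintype.sum_bijective _ (bijective_comp_equiv (q := 2) π) _ _ fun σ => rfl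
    have hS0 : (∑ σ, ψ₀ σ) ≠ 0 := by
      obtain ⟨σ₁, hσ₁⟩ : ∃ σ₁, ψ₀ σ₁ ≠ 0 := Function.ne_iff.mp hψ₀0
      intro hS
      have hre : (∑ σ, ψ₀ σ).re = 0 := by rw [hS, Complex.zero_re]
      rw [Complex.re_sum] at hre
      have hle : (ψ₀ σ₁).re ≤ ∑ σ, (ψ₀ σ).re :=
        Finset.single_le_sum (fun σ _ => (hψ₀pos σ).1) (Finset.mem_univ σ₁)
      have hpos : 0 < (ψ₀ σ₁).re := by
        rcases (hψ₀pos σ₁).1.lt_or_eq with h | h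
        · exact h
        · exact absurd (Complex.ext (by rw [Complex.zero_re]; exact h.symm)
            (by rw [Complex.zero_im]; exact (hψ₀pos σ₁).2)) hσ₁
      linarith
    have hc1 : c = 1 := by
      have h1 : ∑ σ, ψ₀' σ = c * ∑ σ, ψ₀ σ := by
        rw [hc]
        simp only [Pi.smul_apply, smul_eq_mul, Finset.mul_sum]
      rw [hsum] at h1
      have h2 : (1 : ℂ) * ∑ σ, ψ₀ σ = c * ∑ σ, ψ₀ σ := by rw [one_mul]; exact h1
      exact (mul_right_cancel₀ hS0 h2).symm
    rw [hc, hc1, one_smul]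
  -- Step 2: `ψ` is a multiple of the Perron vector.
  obtain ⟨c', hc'⟩ := huniq ψ₀ ψ hψ₀K hψ hψ₀H hH hψ₀0
  funext σ
  have h : ψ₀ (σ ∘ π) = ψ₀ σ := congrFun hfix σ
  rw [hc', Pi.smul_apply, Pi.smul_apply, h]

/-- **Class-constancy on orbits.**  Under the hypotheses of `xxzWith_sectorGS_comp_eq_self`, the
amplitude of a sector ground vector is the same on any two configurations related by a
weight-preserving graph automorphism: `ψ(σ ∘ π) = ψ(σ)`. [folklore] -/
theorem xxzWith_sectorGS_apply_comp (G : SimpleGraph V) [DecidableRel G.Adj] (hG : G.Connected)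
    (J : Sym2 V → ℝ) (hJ : ∀ e ∈ G.edgeFinset, J e < 0) (Δ m : ℝ) (π : V ≃ V)
    (hπ : ∀ x y, G.Adj (π x) (π y) ↔ G.Adj x y) (hJπ : ∀ e : Sym2 V, J (Sym2.map π e) = J e)
    {ψ : TensorIndex V 2 → ℂ} (hψ : ψ ∈ spinZSector (Λ := V) 1 m)
    (hH : xxzHamiltonianWith 1 G J Δ *ᵥ ψ =
      ((lowestEnergyInSector 1 (xxzHamiltonianWith 1 G J Δ) m : ℝ) : ℂ) • ψ) (σ : TensorIndex V 2) :
    ψ (σ ∘ π) = ψ σ :=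
  congrFun (xxzWith_sectorGS_comp_eq_self G hG J hJ Δ m π hπ hJπ hψ hH) σ

end Summit.HubbardSuperconductivity.HubbardSuperconductivity.Theorems.AnisotropyChord.Weighted
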